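import Summits.HodgeConjecture.HodgeConjecture.Theorems.TropicalKugaSatakeCayleyEffectiveCayleyNonRealizabilityRationalFormalization
import Summits.HodgeConjecture.HodgeConjecture.Theses.TropicalKugaSatakeCayley
import HarnessLib

/-!
# Crux `EffectiveCayleyNonRealizability` (stmt-HodgeConjecture-18569) is EQUIVALENT to formal core
# rigidity — the line `formal_rational` closed modulo its one remaining stub, in the tree

Route `TropicalKugaSatakeCayley` of `HodgeConjecture`. The registered line
`Cruxes/EffectiveCayleyNonRealizability/Lines/formal_rational.lean` cuts the crux K1
(`EffectiveCayleyNonRealizability`: a period class realised by EFFECTIVE tropical `2`-cycles of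
`ℝ⁸ / B_t ℤ⁸` at every `t` of a non-empty open subset of the Kuga–Satake cone is a multiple of the
theta class) into three stubs; stubs 1 and 2 are theorems of this seat
(`rationalFormalization`, `identityPrinciple`), so the crux is now reduced to — and here shown
EQUIVALENT to — the third, FORMAL CORE RIGIDITY: an affine-linear formal framed `2`-chain over
`ℚ[t₀,…,t₄]` that is formally a cycle of the family (w.r.t. the period matrix of linear forms
`Σ_i t_i • ksForm i`) and is effective with constant rational period class `Mq` on a non-empty open
subset of the cone has `Mq ∈ ℚ • 1` (one finite, `ℚ`-defined object instead of arbitrary real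
families of cycles; Zharkov p. 3, Kontsevich's "cycles which vary rationally over the space of
parameters").

* `isCycle_map_of_isCycle` — the cycle condition ASCENDS along ANY `ℚ`-algebra base change (no
  injectivity: incidences map to incidences, `FormalCycleCriterion.isCycle_of_incidences`); in
  particular a formal cycle evaluates to a cycle of `ℝ⁸ / B_t ℤ⁸` at EVERY parameter `t`
  (`isCycle_aeval_of_isCycle`).
* `effectiveCayleyNonRealizability_of_formalCoreRigidity` — the skeleton's composition with stubs 1
  and 2 discharged: formal core rigidity ⟹ K1.
* `formalCoreRigidity_of_effectiveCayleyNonRealizability` — conversely K1 ⟹ formal core rigidity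
  (evaluate the formal cycle; a real multiple of `1` that is a rational matrix is a rational
  multiple).
* `effectiveCayleyNonRealizability_iff_formalCoreRigidity` — the equivalence.

No named fact, no new definition, no sorry; the formal-core-rigidity statement is the registered
signature of `stub_formalCoreRigidity` with the skeleton-local `evalChain` / `evalCell` /
`ksMatrixPoly` unfolded verbatim.
References: [Zharkov2020TropicalWeil] I. Zharkov, Tropical abelian varieties, Weil classes and the
Hodge conjecture, arXiv:2002.02347, pp. 2–3; [MikhalkinZharkov2014Eigenwave] G. Mikhalkin,
I. Zharkov, Tropical eigenwave and intermediate Jacobians, LN UMI 15 (2014), Def. 4.2, Prop. 4.3.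
-/

noncomputable section

-- `Summit.HodgeConjecture.HodgeConjecture.…` is the mandated namespace (single-conjunct summit).
set_option linter.dupNamespace false

open scoped BigOperators Matrix

namespace Summit.HodgeConjecture.HodgeConjecture.Theorems.EffectiveCayleyNonRealizability

open Literature.AlgebraicGeometry.Tropical
open Literature.AlgebraicGeometry.Tropical.TropicalTorus
open Summit.HodgeConjecture.HodgeConjecture.Theorems.FormalCycleCriterion
open Summit.HodgeConjecture.HodgeConjecture.Theses.TropicalKugaSatakeCayley

/-! ### The cycle condition ascends along any base change -/

section BaseChange

variable {S S' : Type*} [CommRing S] [CommRing S'] [Algebra ℚ S] [Algebra ℚ S'] {g p : ℕ}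

open Classical in
/-- **Incidence coarsening across two coefficient rings keeps the cycle condition** (the two-ring
form of `FormalCycleCriterion.isCycle_of_incidences`): two `n`-families of framed cells, over `S` and
over `S'`, with the same framings; if every `Per`-incidence between ordered faces of the first is a
`Per'`-incidence between the corresponding ordered faces of the second, then the cycle condition of
the first (torus `S^g / Per ℤ^g`) implies that of the second (torus `S'^g / Per' ℤ^g`): for any tuple
`τ'` the set of face indices of the second family incident to `τ'` is saturated for the equivalence
"faces of the first family are `Per`-translates", whose classes have zero signed-framing sum.
[cite: Zharkov2020TropicalWeil, p. 2] -/
theorem isCycle_of_incidences₂ {n : ℕ} (cell : Fin n → Cell S g p) (cell' : Fin n → Cell S' g p)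
    (Per : Matrix (Fin g) (Fin g) S) (Per' : Matrix (Fin g) (Fin g) S')
    (hfr : ∀ c, (cell' c).framing = (cell c).framing)
    (hinc : ∀ (c c' : Fin n) (i i' : Fin (p + 1)) (π π' : Equiv.Perm (Fin p)),
      IsTranslate Per ((cell c).face i ∘ π) ((cell c').face i' ∘ π') →
        IsTranslate Per' ((cell' c).face i ∘ π) ((cell' c').face i' ∘ π'))
    (hZ : (⟨n, cell⟩ : Chain S g p).IsCycle Per) : (⟨n, cell'⟩ : Chain S' g p).IsCycle Per' := by
  intro τ'
  rw [boundaryCoeff_eq_sum_filter]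
  simp_rw [show ∀ t : Fin n × Fin (p + 1) × Equiv.Perm (Fin p),
      (((Equiv.Perm.sign t.2.2 : ℤˣ) : ℤ) * (-1) ^ (t.2.1 : ℕ) : ℚ) • (cell' t.1).framing =
        (((Equiv.Perm.sign t.2.2 : ℤˣ) : ℤ) * (-1) ^ (t.2.1 : ℕ) : ℚ) • (cell t.1).framing
      from fun t => by rw [hfr]]
  let R : (Fin n × Fin (p + 1) × Equiv.Perm (Fin p)) → (Fin n × Fin (p + 1) × Equiv.Perm (Fin p)) →
      Prop := fun t t' => IsTranslate Per ((cell t.1).face t.2.1 ∘ t.2.2) ((cell t'.1).face t'.2.1 ∘ t'.2.2)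
  have hclass : ∀ t : Fin n × Fin (p + 1) × Equiv.Perm (Fin p),
      ∑ t' ∈ Finset.univ.filter (R t),
        (((Equiv.Perm.sign t'.2.2 : ℤˣ) : ℤ) * (-1) ^ (t'.2.1 : ℕ) : ℚ) • (cell t'.1).framing = 0 := by
    intro t
    have h := hZ ((cell t.1).face t.2.1 ∘ t.2.2)
    rw [boundaryCoeff_eq_sum_filter] at h
    exact h
  refine sum_eq_zero_of_saturated R (fun h => isTranslate_symm h) (fun h h' => isTranslate_trans h h')
    _ hclass _ (fun t _ => isTranslate_refl Per _) ?_
  intro t ht t' htt'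
  rw [Finset.mem_filter] at ht ⊢
  exact ⟨Finset.mem_univ _,
    isTranslate_trans ht.2 (hinc t.1 t'.1 t.2.1 t'.2.1 t.2.2 t'.2.2 htt')⟩

/-- **The cycle condition ascends along ANY `ℚ`-algebra base change** (no injectivity needed): if `Z`
is a tropical cycle of `S^g / Per ℤ^g`, the chain with base vertices and edge coefficients mapped by
`φ` is a tropical cycle of `S'^g / φ(Per) ℤ^g` — every `Per`-incidence of ordered faces maps to a
`φ(Per)`-incidence (`isTranslate_map`, `face_mapCell`), and incidence coarsening keeps the cycle
condition (`isCycle_of_incidences₂`). [cite: Zharkov2020TropicalWeil, p. 2] -/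
theorem isCycle_map_of_isCycle (φ : S →ₐ[ℚ] S') (Per : Matrix (Fin g) (Fin g) S) (Z : Chain S g p)
    (hZ : Z.IsCycle Per) :
    (⟨Z.size, fun c => ⟨fun r => φ ((Z.cell c).base r), (Z.cell c).dir,
        fun i j => φ ((Z.cell c).coef i j), (Z.cell c).weight⟩⟩ : Chain S' g p).IsCycle (Per.map φ) := by
  refine isCycle_of_incidences₂ Z.cell _ Per (Per.map φ) (fun c => rfl) ?_ hZ
  intro c c' i i' π π' hinc
  rw [face_mapCell, face_mapCell]
  exact isTranslate_map φ hinc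

end BaseChange

/-- **A formal cycle of the Kuga–Satake family evaluates to a cycle at every parameter**: if a formal
framed `2`-chain over `ℚ[t₀,…,t₄]` is a cycle w.r.t. `Σ_i t_i • ksForm i`, its evaluation at any
`t ∈ ℝ⁵` is a tropical cycle of `ℝ⁸ / B_t ℤ⁸`. [cite: Zharkov2020TropicalWeil, p. 3] -/
theorem isCycle_aeval_of_isCycle (𝒵 : Chain (MvPolynomial (Fin 5) ℚ) 8 2)
    (h𝒵 : 𝒵.IsCycle (∑ i : Fin 5, (MvPolynomial.X i : MvPolynomial (Fin 5) ℚ) •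
      (ksForm i).map (Int.cast : ℤ → MvPolynomial (Fin 5) ℚ))) (t : Fin 5 → ℝ) :
    (⟨𝒵.size, fun c => ⟨fun r => MvPolynomial.aeval t ((𝒵.cell c).base r), (𝒵.cell c).dir,
        fun i j => MvPolynomial.aeval t ((𝒵.cell c).coef i j), (𝒵.cell c).weight⟩⟩ :
        Chain ℝ 8 2).IsCycle (ksMatrix t) := by
  rw [← ksMatrixPoly_map_aeval t]
  exact isCycle_map_of_isCycle (MvPolynomial.aeval t) _ 𝒵 h𝒵

/-- Casting the rational theta multiple `r • 1` to real matrices gives `(r : ℝ) • 1`. [folklore] -/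
theorem map_ratCast_smul_one (r : ℚ) :
    (r • (1 : Matrix (Sub 8 2) (Sub 8 2) ℚ)).map (algebraMap ℚ ℝ) =
      (r : ℝ) • (1 : Matrix (Sub 8 2) (Sub 8 2) ℝ) := by
  ext i j
  by_cases h : i = j
  · subst h; simp
  · simp [Matrix.one_apply_ne h]

/-- A rational matrix which is a REAL multiple of the identity is a RATIONAL multiple of the
identity (read the multiplier off a diagonal entry). [folklore] -/
theorem exists_rat_smul_one_of_map_eq_smul_one (Mq : Matrix (Sub 8 2) (Sub 8 2) ℚ) (r : ℝ)
    (h : Mq.map (algebraMap ℚ ℝ) = r • (1 : Matrix (Sub 8 2) (Sub 8 2) ℝ)) :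
    ∃ q : ℚ, Mq = q • (1 : Matrix (Sub 8 2) (Sub 8 2) ℚ) := by
  let K₀ : Sub 8 2 := ⟨{0, 1}, by decide⟩
  have hr : (Mq K₀ K₀ : ℝ) = r := by
    have := congr_fun (congr_fun h K₀) K₀
    simpa using this
  refine ⟨Mq K₀ K₀, ?_⟩
  ext i j
  have hij := congr_fun (congr_fun h i) j
  rw [← hr] at hij
  have hij' : (Mq i j : ℝ) = ((Mq K₀ K₀ * (1 : Matrix (Sub 8 2) (Sub 8 2) ℚ) i j : ℚ) : ℝ) := by
    rw [Matrix.map_apply, eq_ratCast, Matrix.smul_apply, smul_eq_mul] at hij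
    rw [hij]
    by_cases hd : i = j
    · subst hd; simp
    · simp [Matrix.one_apply_ne hd]
  rw [Matrix.smul_apply, smul_eq_mul]
  exact_mod_cast hij'

/-! ### The crux and formal core rigidity -/

/-- **Formal core rigidity ⟹ the crux** — the composition of the registered line `formal_rational`
with its stubs 1 (`rationalFormalization`) and 2 (`identityPrinciple`) discharged: realisability of
`M` on `U` ⟶ an affine-linear rational formal chain realising `M` effectively on an open `V ⊆ U` ⟶
it is formally a cycle and `M = Mq` is rational ⟶ (formal core rigidity) `Mq = r • 1` ⟶ `M = r • 1`.
The hypothesis is the registered signature of `stub_formalCoreRigidity` with the skeleton-local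
definitions unfolded. [cite: Zharkov2020TropicalWeil, p. 3] -/
theorem effectiveCayleyNonRealizability_of_formalCoreRigidity
    (h₃ : ∀ 𝒵 : Chain (MvPolynomial (Fin 5) ℚ) 8 2, 𝒵.IsAffineLinear →
      𝒵.IsCycle (∑ i : Fin 5, (MvPolynomial.X i : MvPolynomial (Fin 5) ℚ) •
        (ksForm i).map (Int.cast : ℤ → MvPolynomial (Fin 5) ℚ)) →
      ∀ V : Set (Fin 5 → ℝ), IsOpen V → V.Nonempty → V ⊆ ksPosCone →
        ∀ Mq : Matrix (Sub 8 2) (Sub 8 2) ℚ,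
          (∀ t ∈ V,
            (⟨𝒵.size, fun c => ⟨fun r => MvPolynomial.aeval t ((𝒵.cell c).base r), (𝒵.cell c).dir,
                fun i j => MvPolynomial.aeval t ((𝒵.cell c).coef i j), (𝒵.cell c).weight⟩⟩ :
                Chain ℝ 8 2).Effective ∧
              compound 2 (ksMatrix t)⁻¹ *
                (⟨𝒵.size, fun c => ⟨fun r => MvPolynomial.aeval t ((𝒵.cell c).base r),
                    (𝒵.cell c).dir, fun i j => MvPolynomial.aeval t ((𝒵.cell c).coef i j),
                    (𝒵.cell c).weight⟩⟩ : Chain ℝ 8 2).classOf = Mq.map (algebraMap ℚ ℝ)) →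
          ∃ r : ℚ, Mq = r • (1 : Matrix (Sub 8 2) (Sub 8 2) ℚ)) :
    EffectiveCayleyNonRealizability := by
  intro U hU hne hsub M hM
  obtain ⟨𝒵, hlin, V, hVo, hVne, hVU, hV⟩ := rationalFormalization U hU hne hsub M hM
  have hVcone : V ⊆ ksPosCone := hVU.trans hsub
  obtain ⟨hcyc, ⟨Mq, hMq⟩, -⟩ :=
    identityPrinciple 𝒵 hlin V hVo hVne hVcone M (fun t ht => ⟨(hV t ht).1, (hV t ht).2.2⟩)
  obtain ⟨r, hr⟩ := h₃ 𝒵 hlin hcyc V hVo hVne hVcone Mq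
    (fun t ht => ⟨(hV t ht).2.1, hMq ▸ (hV t ht).2.2⟩)
  exact ⟨(r : ℝ), by rw [hMq, hr, map_ratCast_smul_one]⟩

/-- **The crux ⟹ formal core rigidity**: the evaluations of a formal cycle are cycles at every
parameter (`isCycle_aeval_of_isCycle`), so on `V` they realise `Mq` effectively; the crux makes
`Mq` a real, hence rational, multiple of `1`. [cite: Zharkov2020TropicalWeil, p. 3] -/
theorem formalCoreRigidity_of_effectiveCayleyNonRealizability (hK : EffectiveCayleyNonRealizability) :
    ∀ 𝒵 : Chain (MvPolynomial (Fin 5) ℚ) 8 2, 𝒵.IsAffineLinear →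
      𝒵.IsCycle (∑ i : Fin 5, (MvPolynomial.X i : MvPolynomial (Fin 5) ℚ) •
        (ksForm i).map (Int.cast : ℤ → MvPolynomial (Fin 5) ℚ)) →
      ∀ V : Set (Fin 5 → ℝ), IsOpen V → V.Nonempty → V ⊆ ksPosCone →
        ∀ Mq : Matrix (Sub 8 2) (Sub 8 2) ℚ,
          (∀ t ∈ V,
            (⟨𝒵.size, fun c => ⟨fun r => MvPolynomial.aeval t ((𝒵.cell c).base r), (𝒵.cell c).dir,
                fun i j => MvPolynomial.aeval t ((𝒵.cell c).coef i j), (𝒵.cell c).weight⟩⟩ :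
                Chain ℝ 8 2).Effective ∧
              compound 2 (ksMatrix t)⁻¹ *
                (⟨𝒵.size, fun c => ⟨fun r => MvPolynomial.aeval t ((𝒵.cell c).base r),
                    (𝒵.cell c).dir, fun i j => MvPolynomial.aeval t ((𝒵.cell c).coef i j),
                    (𝒵.cell c).weight⟩⟩ : Chain ℝ 8 2).classOf = Mq.map (algebraMap ℚ ℝ)) →
          ∃ r : ℚ, Mq = r • (1 : Matrix (Sub 8 2) (Sub 8 2) ℚ) := by
  intro 𝒵 _ hcyc V hVo hVne hVcone Mq hV
  obtain ⟨r, hr⟩ := hK V hVo hVne hVcone (Mq.map (algebraMap ℚ ℝ))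
    (fun t ht => ⟨_, isCycle_aeval_of_isCycle 𝒵 hcyc t, (hV t ht).1, (hV t ht).2⟩)
  exact exists_rat_smul_one_of_map_eq_smul_one Mq r hr

/-- **THE CRUX IS EQUIVALENT TO FORMAL CORE RIGIDITY.** `EffectiveCayleyNonRealizability` (K1 of the
route `TropicalKugaSatakeCayley`) holds iff every affine-linear formal framed `2`-chain over
`ℚ[t₀,…,t₄]` that is formally a cycle of the Kuga–Satake family and is effective with constant
rational period class `Mq` on a non-empty open subset of the cone has `Mq ∈ ℚ • 1` — the one
remaining registered stub `stub_formalCoreRigidity` of the line `formal_rational` (unfolded).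
[cite: Zharkov2020TropicalWeil, p. 3] [cite: MikhalkinZharkov2014Eigenwave, Prop. 4.3] -/
theorem effectiveCayleyNonRealizability_iff_formalCoreRigidity :
    EffectiveCayleyNonRealizability ↔
      ∀ 𝒵 : Chain (MvPolynomial (Fin 5) ℚ) 8 2, 𝒵.IsAffineLinear →
        𝒵.IsCycle (∑ i : Fin 5, (MvPolynomial.X i : MvPolynomial (Fin 5) ℚ) •
          (ksForm i).map (Int.cast : ℤ → MvPolynomial (Fin 5) ℚ)) →
        ∀ V : Set (Fin 5 → ℝ), IsOpen V → V.Nonempty → V ⊆ ksPosCone →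
          ∀ Mq : Matrix (Sub 8 2) (Sub 8 2) ℚ,
            (∀ t ∈ V,
              (⟨𝒵.size, fun c => ⟨fun r => MvPolynomial.aeval t ((𝒵.cell c).base r),
                  (𝒵.cell c).dir, fun i j => MvPolynomial.aeval t ((𝒵.cell c).coef i j),
                  (𝒵.cell c).weight⟩⟩ : Chain ℝ 8 2).Effective ∧
                compound 2 (ksMatrix t)⁻¹ *
                  (⟨𝒵.size, fun c => ⟨fun r => MvPolynomial.aeval t ((𝒵.cell c).base r),
                      (𝒵.cell c).dir, fun i j => MvPolynomial.aeval t ((𝒵.cell c).coef i j),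
                      (𝒵.cell c).weight⟩⟩ : Chain ℝ 8 2).classOf = Mq.map (algebraMap ℚ ℝ)) →
            ∃ r : ℚ, Mq = r • (1 : Matrix (Sub 8 2) (Sub 8 2) ℚ) :=
  ⟨formalCoreRigidity_of_effectiveCayleyNonRealizability,
    effectiveCayleyNonRealizability_of_formalCoreRigidity⟩

end Summit.HodgeConjecture.HodgeConjecture.Theorems.EffectiveCayleyNonRealizability

end
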